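import Summits.BirchSwinnertonDyer.BirchSwinnertonDyer.Theorems.TwoAdicConverseOrdLambdaHalfAtTwoShapiroDatumKernel
import Summits.BirchSwinnertonDyer.BirchSwinnertonDyer.Theorems.TwoAdicConverseOrdLambdaHalfAtTwoPinnedMinusSide
import HarnessLib

/-!
# Route `TwoAdicConverse` (rung S3), crux `OrdLambdaHalfAtTwo` (item stmt-BirchSwinnertonDyer-19556), line
# `kato-determinant-greenberg-two`, skeleton v4.3: the `F⁻`-SUMMAND of the Kato determinant READ BY THE FIRST RECIPROCITY LAW —
# ported from the v4 datum (p675636) to the Poitou–Tate-free core `PinnedKatoCore`, hence valid for the Shapiro-corrected datum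

Seat `cruxlead-stmt-BirchSwinnertonDyer-19556-g2` (LEAD PROVER, MODE LINE; `--supports` stmt-BirchSwinnertonDyer-19556, helper; HOME
`run/shared/lean/pub/bsd-2adic/`).  HONEST FRAMING (cell bsd-2adic): BSD is not proved by any of this; the crux `OrdLambdaHalfAtTwo` is NOT proved
here; nothing about any particular curve is asserted; no named fact, no `sorry`; four auxiliary definitions with bodies (the reciprocity values,
their ideal, the zeta span modulo `H_f`, the comparison map `Col⁻` induces) exactly as in p675636, now on the core.

WHY: lead g1's kernel theorem p675636 (`PinnedKatoGreenbergDatum.lambda_minusSide_eq_lambda_quotient_span_pair`: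
`λ(𝐇¹_loc ⧸ (H_f ⊔ S)) = λ(Λ ⧸ (L₀, L₀'))`, hence `gD = λ(H_f ⧸ (H_f ⊓ S)) + λ(Λ ⧸ (L₀, L₀'))` and «stub 6′ is about the `F⁺`-summand alone») uses ONLY
the compact-side fields (`colMinus`, its kernel/cokernel clauses, `recW`, `recA`, `finiteHl`, `isTorsion_quot`).  Skeleton v4.3 (triage r1-1 Δ16-1/Δ17-2,
repair R1) re-types the `K`-side Poitou–Tate fields, so the v4 structure is superseded by `ShapiroKatoGreenbergDatum … extends PinnedKatoCore` (Defs
`…ShapiroDatumDefs`, kernel `…ShapiroDatumKernel`).  THIS FILE re-proves p675636 §2 VERBATIM on `PinnedKatoCore` (proofs line for line; the generic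
algebra lemmas of p675636 §1 are imported, not copied) and records the consequence for the Shapiro datum:
`ShapiroKatoGreenbergDatum.gD_eq_lambda_plusSide_add` / `gD_le_lambda_iff_plusSide` — stub 6″ is, datum by datum,
`λ(H_f ⧸ (H_f ⊓ S)) + λ(Λ ⧸ (L₀, L₀')) ≤ λ(X_Gr)`, exactly as 6′ was.  Every future re-typing of the `K`-side inherits these through `toPinnedKatoCore`.

References: K. Kato, Astérisque 295 (2004), Thm 16.4, Thm 16.6, Prop 17.11, §17.13 [Kato2004Asterisque]; B. Perrin-Riou, Invent. Math. 115 (1994)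
[PerrinRiou1994Invent]; L. Washington, GTM 83, §13.2 [Washington1997].
-/

set_option linter.dupNamespace false
set_option autoImplicit false

noncomputable section

open scoped Classical NumberField
open WeierstrassCurve NumberField IsDedekindDomain Field CategoryTheory
open Literature.NumberTheory.EllipticCurves Literature.NumberTheory.EllipticCurves.Rank1Residual
open Literature.NumberTheory.EllipticCurves.Kato2004 Literature.NumberTheory.EllipticCurves.Kato2004.EulerSystemValues
open Literature.NumberTheory.GaloisRepresentations
open Summit.BirchSwinnertonDyer.Rank1Residual.X1.MuLambda (lam)
open Summit.BirchSwinnertonDyer.Rank1Residual.X11b (AcSelmer.bdpData AcSelmer.strictDatum)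

namespace Summit.BirchSwinnertonDyer.BirchSwinnertonDyer.Theorems.TwoAdicKatoDeterminant

/-! ## §1 The `F⁻`-summand of a core -/

section Core

variable {W : WeierstrassCurve ℚ} [W.IsElliptic] [ContinuousSMul ℤ_[2] (W.tateModule 2)]
  {A : WeierstrassCurve ℚ} [A.IsElliptic] [ContinuousSMul ℤ_[2] (A.tateModule 2)]
  {κ : ZpExtension ℚ 2} {γ : absoluteGaloisGroup ℚ}
  {I_W : IwasawaH1Data W 2 κ γ} {I_A : IwasawaH1Data A 2 κ γ}
  {v : HeightOneSpectrum (𝓞 ℚ)} {γᵥ : absoluteGaloisGroup (v.adicCompletion ℚ)}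
  {J : LocalIwasawaH1Data κ v ((tateRep W 2).toLocal v) γᵥ}
  {J' : LocalIwasawaH1Data κ v (tateLocalOrdinaryRep W 2 v) γᵥ}
  {J_A : LocalIwasawaH1Data κ v ((tateRep A 2).toLocal v) γᵥ}
  {uA : ((tateRep A 2).toLocal v).toTopRep ⟶ ((tateRep W 2).toLocal v).toTopRep}
  {hsurj : Function.Surjective
    (κ.toContinuousMonoidHom.comp (resGalOfEmb (closureEmb (K := ℚ) (v.adicCompletion ℚ))))}
  {hγ : κ.IsTopGenerator γ}
  {hγᵥ : κ.IsTopGenerator (resGalOfEmb (closureEmb (K := ℚ) (v.adicCompletion ℚ)) γᵥ)}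
  {L₀ L₀' : IwasawaAlgebra 2}

namespace PinnedKatoCore

variable (C : PinnedKatoCore I_W I_A J J' J_A uA hsurj hγ hγᵥ L₀ L₀')

/-- The two reciprocity values of the core, as generators: `a_E = u_E · 2^{n_E} · L₀`. [cite: Kato2004Asterisque, Thm 16.6 (2)] -/
def recValueW : IwasawaAlgebra 2 := (C.unitW : IwasawaAlgebra 2) * PowerSeries.C ((2 : ℤ_[2]) ^ C.nW) * L₀

/-- The two reciprocity values of the core, as generators: `a_A = u_A · 2^{n_A} · L₀'`. [cite: Kato2004Asterisque, Thm 16.6 (2)] -/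
def recValueA : IwasawaAlgebra 2 := (C.unitA : IwasawaAlgebra 2) * PowerSeries.C ((2 : ℤ_[2]) ^ C.nA) * L₀'

/-- The ideal of `Λ` generated by the two reciprocity values. [cite: Kato2004Asterisque, Thm 16.6 (2)] -/
def recIdeal : Ideal (IwasawaAlgebra 2) := Ideal.span {C.recValueW} ⊔ Ideal.span {C.recValueA}

/-- The localised zeta span read modulo `H_f`: `S̄ = S.map (Hl → Hl⧸H_f)`. [cite: Kato2004Asterisque, §17.13 (17.13.1)] -/
def zetaSpanBar : Submodule (IwasawaAlgebra 2) (J.H ⧸ localOrdinaryPart J' J) :=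
  C.zetaSpan.map (localOrdinaryPart J' J).mkQ

/-- `Col⁻(S̄)` is the ideal generated by the two reciprocity values (`map_span` + the fields `recW`, `recA`).
[cite: Kato2004Asterisque, Thm 16.6 (2)] -/
theorem map_colMinus_zetaSpanBar : C.zetaSpanBar.map C.colMinus = C.recIdeal := by
  rw [zetaSpanBar, zetaSpan, Submodule.map_sup, Submodule.map_sup, ← Submodule.map_comp, ← Submodule.map_comp,
    ← Submodule.map_comp, ← Submodule.map_comp, Submodule.map_span, Submodule.map_span, Set.image_singleton,
    Set.image_singleton, recIdeal, recValueW, recValueA]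
  have hW : ((C.colMinus ∘ₗ (localOrdinaryPart J' J).mkQ) ∘ₗ I_W.loc J hsurj hγ hγᵥ) C.zW =
      (C.unitW : IwasawaAlgebra 2) * PowerSeries.C ((2 : ℤ_[2]) ^ C.nW) * L₀ := by
    simp only [LinearMap.coe_comp, Function.comp_apply]
    exact C.recW
  have hA : ((C.colMinus ∘ₗ (localOrdinaryPart J' J).mkQ) ∘ₗ (J_A.map uA J ∘ₗ I_A.loc J_A hsurj hγ hγᵥ)) C.zA =
      (C.unitA : IwasawaAlgebra 2) * PowerSeries.C ((2 : ℤ_[2]) ^ C.nA) * L₀' := by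
    simp only [LinearMap.coe_comp, Function.comp_apply]
    exact C.recA
  rw [hW, hA]

/-- The reciprocity value `a_E` is non-zero when `L₀ ≠ 0`. [folklore] -/
theorem recValueW_ne_zero (hL₀ : L₀ ≠ 0) : C.recValueW ≠ 0 := by
  rw [recValueW]
  refine mul_ne_zero (mul_ne_zero C.unitW.ne_zero ?_) hL₀
  exact Summit.BirchSwinnertonDyer.Rank1Residual.X1.MuLambda.C_pow_ne_zero C.nW

/-- `Λ ⧸ (a_E, a_A)` is `Λ`-torsion (`a_E ≠ 0`). [folklore] -/
theorem isTorsion_quotient_recIdeal (hL₀ : L₀ ≠ 0) :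
    Module.IsTorsion (IwasawaAlgebra 2) (IwasawaAlgebra 2 ⧸ C.recIdeal) :=
  isTorsion_quotient_of_ne_zero_mem (C.recValueW_ne_zero hL₀)
    (Submodule.mem_sup_left (Ideal.mem_span_singleton_self _))

/-- The comparison map `φ : (Hl⧸H_f)⧸S̄ → Λ⧸(a_E, a_A)` induced by `Col⁻`. [cite: Kato2004Asterisque, Prop 17.11 (shape)] -/
def colMinusBar : ((J.H ⧸ localOrdinaryPart J' J) ⧸ C.zetaSpanBar) →ₗ[IwasawaAlgebra 2]
    (IwasawaAlgebra 2 ⧸ C.recIdeal) :=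
  C.zetaSpanBar.mapQ C.recIdeal C.colMinus (by rw [← C.map_colMinus_zetaSpanBar]; exact Submodule.le_comap_map _ _)

/-- Every element of `ker φ` is killed by a power of `2` (the kernel of `Col⁻` is). [cite: Kato2004Asterisque, Prop 17.11 (shape)] -/
theorem exists_C_pow_smul_eq_zero_of_mem_ker (x : LinearMap.ker C.colMinusBar) :
    ∃ k : ℕ, (PowerSeries.C ((2 : ℤ_[2]) ^ k) : IwasawaAlgebra 2) • x = 0 := by
  obtain ⟨x, hx⟩ := x
  obtain ⟨q, rfl⟩ := Submodule.mkQ_surjective _ x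
  rw [LinearMap.mem_ker, Submodule.mkQ_apply, colMinusBar, Submodule.mapQ_apply, Submodule.Quotient.mk_eq_zero,
    ← map_colMinus_zetaSpanBar, Submodule.mem_map] at hx
  obtain ⟨s, hs, hsq⟩ := hx
  obtain ⟨k, hk⟩ := C.colMinus_ker (q - s) (by rw [map_sub, hsq, sub_self])
  refine ⟨k, Subtype.ext ?_⟩
  change (PowerSeries.C ((2 : ℤ_[2]) ^ k) : IwasawaAlgebra 2) • (Submodule.mkQ _ q) = 0
  have hqs : (PowerSeries.C ((2 : ℤ_[2]) ^ k) : IwasawaAlgebra 2) • q =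
      (PowerSeries.C ((2 : ℤ_[2]) ^ k) : IwasawaAlgebra 2) • s := by
    rw [smul_sub, sub_eq_zero] at hk
    exact hk
  rw [← map_smul, hqs, map_smul, Submodule.mkQ_apply, (Submodule.Quotient.mk_eq_zero _).mpr hs, smul_zero]

/-- `λ(ker φ) = 0`. [cite: Washington1997, §13.2] -/
theorem lambdaInvariant_ker_colMinusBar : lambdaInvariant 2 (LinearMap.ker C.colMinusBar) = 0 :=
  lambdaInvariant_eq_zero_of_forall_exists_C_pow_smul_eq_zero C.exists_C_pow_smul_eq_zero_of_mem_ker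

/-- The range of `φ` is the image of `range Col⁻` in `Λ⧸(a_E, a_A)`. [folklore] -/
theorem range_colMinusBar :
    LinearMap.range C.colMinusBar = (LinearMap.range C.colMinus).map C.recIdeal.mkQ := by
  have h : C.colMinusBar ∘ₗ C.zetaSpanBar.mkQ = C.recIdeal.mkQ ∘ₗ C.colMinus := Submodule.mapQ_mkQ _ _ _
  rw [← LinearMap.range_comp, ← h, LinearMap.range_comp, Submodule.range_mkQ, Submodule.map_top]

/-- The cokernel of `φ` is finite (a quotient of the finite cokernel of `Col⁻`). [cite: Kato2004Asterisque, Prop 17.11 (shape)] -/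
theorem finite_coker_colMinusBar :
    Finite ((IwasawaAlgebra 2 ⧸ C.recIdeal) ⧸ LinearMap.range C.colMinusBar) := by
  haveI := C.colMinus_coker
  let g : (IwasawaAlgebra 2 ⧸ LinearMap.range C.colMinus) →ₗ[IwasawaAlgebra 2]
      ((IwasawaAlgebra 2 ⧸ C.recIdeal) ⧸ LinearMap.range C.colMinusBar) :=
    (LinearMap.range C.colMinus).mapQ _ C.recIdeal.mkQ
      (by rw [range_colMinusBar]; exact Submodule.le_comap_map _ _)
  refine Finite.of_surjective g fun y ↦ ?_
  obtain ⟨y, rfl⟩ := Submodule.mkQ_surjective _ y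
  obtain ⟨z, rfl⟩ := Submodule.mkQ_surjective _ y
  exact ⟨Submodule.mkQ _ z, by rw [Submodule.mkQ_apply, Submodule.mapQ_apply]; rfl⟩

/-- **The `F⁻`-summand is read by the first reciprocity law**: for every core with `L₀ ≠ 0`,
`λ(Hl ⧸ (H_f ⊔ S)) = λ(Λ ⧸ (u_E·2^{n_E}·L₀, u_A·2^{n_A}·L₀'))`. [cite: Kato2004Asterisque, Thm 16.6 (2) and Prop 17.11 (shape; the fields recW/recA)]
[cite: Washington1997, §13.2] -/
theorem lambda_minusSide_eq (hL₀ : L₀ ≠ 0) :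
    lambdaInvariant 2 (J.H ⧸ (localOrdinaryPart J' J ⊔ C.zetaSpan)) =
      lambdaInvariant 2 (IwasawaAlgebra 2 ⧸ C.recIdeal) := by
  haveI := C.finiteHl
  -- `(Hl⧸H_f)⧸S̄ ≅ Hl⧸(H_f ⊔ S)`, torsion as a quotient of `Hl⧸S`
  let e := Submodule.quotientQuotientEquivQuotientSup (localOrdinaryPart J' J) C.zetaSpan
  have htorS : Module.IsTorsion (IwasawaAlgebra 2) (J.H ⧸ C.zetaSpan) := C.isTorsion_quot
  have htor1 : Module.IsTorsion (IwasawaAlgebra 2) (J.H ⧸ (localOrdinaryPart J' J ⊔ C.zetaSpan)) :=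
    TwoAdicPoitouTateTwoWays.isTorsion_of_surjective 2
      (C.zetaSpan.mapQ (localOrdinaryPart J' J ⊔ C.zetaSpan) LinearMap.id le_sup_right)
      (fun y ↦ by
        obtain ⟨y, rfl⟩ := Submodule.mkQ_surjective _ y
        exact ⟨Submodule.mkQ _ y, by rw [Submodule.mkQ_apply, Submodule.mapQ_apply]; rfl⟩) htorS
  have htor2 : Module.IsTorsion (IwasawaAlgebra 2) ((J.H ⧸ localOrdinaryPart J' J) ⧸ C.zetaSpanBar) :=
    TwoAdicPoitouTateTwoWays.isTorsion_of_injective 2 e.toLinearMap e.injective htor1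
  rw [← lambdaInvariant_eq_of_linearEquiv e]
  change lambdaInvariant 2 ((J.H ⧸ localOrdinaryPart J' J) ⧸ C.zetaSpanBar) = _
  -- `λ((Hl⧸H_f)⧸S̄) = λ(ker φ) + λ(range φ)`
  have h1 := Summit.BirchSwinnertonDyer.Rank1Residual.X2.DualRestrictionInvariants.lambdaInvariant_eq_add_of_surjective 2
    (π := C.colMinusBar.rangeRestrict) htor2 (LinearMap.surjective_rangeRestrict _)
  rw [LinearMap.ker_rangeRestrict, lambdaInvariant_ker_colMinusBar, zero_add] at h1
  -- `λ(Λ⧸(a_E,a_A)) = λ(range φ) + λ(coker φ)`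
  have h2 := Summit.BirchSwinnertonDyer.Rank1Residual.X2.DualRestrictionInvariants.lambdaInvariant_eq_add_of_surjective 2
    (π := (LinearMap.range C.colMinusBar).mkQ) (C.isTorsion_quotient_recIdeal hL₀) (Submodule.mkQ_surjective _)
  haveI := C.finite_coker_colMinusBar
  rw [lambdaInvariant_eq_of_linearEquiv (LinearEquiv.ofEq _ _ (Submodule.ker_mkQ _)),
    IwasawaTwoVariable.lambdaInvariant_eq_zero_of_finite 2
      (X := (IwasawaAlgebra 2 ⧸ C.recIdeal) ⧸ LinearMap.range C.colMinusBar), add_zero] at h2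
  rw [h1, h2]

/-- The units and powers of `2` are `λ`-invisible: `λ(Λ ⧸ (a_E, a_A)) = λ(Λ ⧸ (L₀, L₀'))`. [cite: Washington1997, §13.2] -/
theorem lambdaInvariant_quotient_recIdeal_eq (hL₀ : L₀ ≠ 0) :
    lambdaInvariant 2 (IwasawaAlgebra 2 ⧸ C.recIdeal) =
      lambdaInvariant 2 (IwasawaAlgebra 2 ⧸ (Ideal.span {L₀} ⊔ Ideal.span {L₀'})) := by
  set Jd : Ideal (IwasawaAlgebra 2) := Ideal.span {L₀} ⊔ Ideal.span {L₀'} with hJd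
  have hIJ : C.recIdeal ≤ Jd := by
    refine sup_le ?_ ?_
    · rw [Ideal.span_singleton_le_iff_mem, recValueW]
      exact Submodule.mem_sup_left (Ideal.mem_span_singleton.mpr (Dvd.intro_left _ rfl))
    · rw [Ideal.span_singleton_le_iff_mem, recValueA]
      exact Submodule.mem_sup_right (Ideal.mem_span_singleton.mpr (Dvd.intro_left _ rfl))
  have h := TwoAdicPoitouTateTwoWays.lambdaInvariant_quotient_eq_add 2 C.recIdeal Jd hIJ
    (C.isTorsion_quotient_recIdeal hL₀)
  -- `Jd ⧸ recIdeal` is killed by `2^{n_E + n_A}`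
  have hkill : ∀ x : ↥(Submodule.map C.recIdeal.mkQ Jd),
      (PowerSeries.C ((2 : ℤ_[2]) ^ (C.nW + C.nA)) : IwasawaAlgebra 2) • x = 0 := by
    rintro ⟨x, hx⟩
    obtain ⟨j, hj, rfl⟩ := Submodule.mem_map.mp hx
    refine Subtype.ext ?_
    change (PowerSeries.C ((2 : ℤ_[2]) ^ (C.nW + C.nA)) : IwasawaAlgebra 2) • C.recIdeal.mkQ j = 0
    rw [← map_smul, Submodule.mkQ_apply, Submodule.Quotient.mk_eq_zero, smul_eq_mul]
    obtain ⟨y, hy, z, hz, rfl⟩ := Submodule.mem_sup.mp hj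
    obtain ⟨r, rfl⟩ := Ideal.mem_span_singleton'.mp hy
    obtain ⟨r', rfl⟩ := Ideal.mem_span_singleton'.mp hz
    rw [mul_add]
    refine Submodule.add_mem _ (Submodule.mem_sup_left ?_) (Submodule.mem_sup_right ?_)
    · refine Ideal.mem_span_singleton'.mpr ⟨r * (↑C.unitW⁻¹ : IwasawaAlgebra 2) * PowerSeries.C ((2 : ℤ_[2]) ^ C.nA), ?_⟩
      rw [recValueW, pow_add, map_mul]
      have hu : (↑C.unitW⁻¹ : IwasawaAlgebra 2) * (C.unitW : IwasawaAlgebra 2) = 1 := Units.inv_mul _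
      linear_combination (r * PowerSeries.C ((2 : ℤ_[2]) ^ C.nA) * PowerSeries.C ((2 : ℤ_[2]) ^ C.nW) * L₀) * hu
    · refine Ideal.mem_span_singleton'.mpr ⟨r' * (↑C.unitA⁻¹ : IwasawaAlgebra 2) * PowerSeries.C ((2 : ℤ_[2]) ^ C.nW), ?_⟩
      rw [recValueA, pow_add, map_mul]
      have hu : (↑C.unitA⁻¹ : IwasawaAlgebra 2) * (C.unitA : IwasawaAlgebra 2) = 1 := Units.inv_mul _
      linear_combination (r' * PowerSeries.C ((2 : ℤ_[2]) ^ C.nW) * PowerSeries.C ((2 : ℤ_[2]) ^ C.nA) * L₀') * hu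
  have hzero : lambdaInvariant 2 ↥(Submodule.map C.recIdeal.mkQ Jd) = 0 :=
    lambdaInvariant_eq_zero_of_forall_exists_C_pow_smul_eq_zero fun x ↦ ⟨C.nW + C.nA, hkill x⟩
  rw [h, hzero, zero_add]

/-- **The `F⁻`-summand in final form**: `λ(Hl ⧸ (H_f ⊔ S)) = λ(Λ ⧸ (L₀, L₀'))` for every core with `L₀ ≠ 0`.
[cite: Kato2004Asterisque, Thm 16.6 (2), Prop 17.11 (shape)] [cite: Washington1997, §13.2] -/
theorem lambda_minusSide_eq_lambda_quotient_span_pair (hL₀ : L₀ ≠ 0) :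
    lambdaInvariant 2 (J.H ⧸ (localOrdinaryPart J' J ⊔ C.zetaSpan)) =
      lambdaInvariant 2 (IwasawaAlgebra 2 ⧸ (Ideal.span {L₀} ⊔ Ideal.span {L₀'})) := by
  rw [C.lambda_minusSide_eq hL₀, C.lambdaInvariant_quotient_recIdeal_eq hL₀]

/-- `λ(Hl ⧸ (H_f ⊔ S)) ≤ λ(L₀)` — the `F⁻`-summand is bounded by Kato's own `λ`. [cite: Kato2004Asterisque, Thm 16.6 (2) (shape)] -/
theorem lambda_minusSide_le_lam (hL₀ : L₀ ≠ 0) :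
    lambdaInvariant 2 (J.H ⧸ (localOrdinaryPart J' J ⊔ C.zetaSpan)) ≤ lam L₀ := by
  rw [C.lambda_minusSide_eq_lambda_quotient_span_pair hL₀]
  exact PinnedKatoGreenbergDatum.lambdaInvariant_quotient_span_pair_le_lam hL₀

/-- `λ(Hl ⧸ (H_f ⊔ S)) ≤ λ(L₀')`. [cite: Kato2004Asterisque, Thm 16.6 (2) (shape)] -/
theorem lambda_minusSide_le_lam' (hL₀ : L₀ ≠ 0) (hL₀' : L₀' ≠ 0) :
    lambdaInvariant 2 (J.H ⧸ (localOrdinaryPart J' J ⊔ C.zetaSpan)) ≤ lam L₀' := by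
  rw [C.lambda_minusSide_eq_lambda_quotient_span_pair hL₀]
  exact PinnedKatoGreenbergDatum.lambdaInvariant_quotient_span_pair_le_lam' hL₀'


/-! ## §2 Consequence: `gD` of a core, and the research stub 6″ datum by datum -/

/-- **`gD = λ(H_f ⧸ (H_f ⊓ S)) + λ(Λ ⧸ (L₀, L₀'))`** for every core with `L₀ ≠ 0`. [cite: Kato2004Asterisque, Thm 16.6 (2), §17.13 (shape)] -/
theorem gD_eq_lambda_plusSide_add (hL₀ : L₀ ≠ 0) :
    C.gD = lambdaInvariant 2 (↥(localOrdinaryPart J' J) ⧸ (C.zetaSpan).comap (localOrdinaryPart J' J).subtype) +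
      lambdaInvariant 2 (IwasawaAlgebra 2 ⧸ (Ideal.span {L₀} ⊔ Ideal.span {L₀'})) := by
  rw [C.gD_eq_lambda_plus_add_lambda_minus, C.lambda_minusSide_eq_lambda_quotient_span_pair hL₀]

end PinnedKatoCore

end Core

section Shapiro

variable {W : WeierstrassCurve ℚ} [W.IsElliptic] [ContinuousSMul ℤ_[2] (W.tateModule 2)]
  {A : WeierstrassCurve ℚ} [A.IsElliptic] [ContinuousSMul ℤ_[2] (A.tateModule 2)]
  {κ : ZpExtension ℚ 2} {γ : absoluteGaloisGroup ℚ}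
  {I_W : IwasawaH1Data W 2 κ γ} {I_A : IwasawaH1Data A 2 κ γ}
  {v : HeightOneSpectrum (𝓞 ℚ)} {γᵥ : absoluteGaloisGroup (v.adicCompletion ℚ)}
  {J : LocalIwasawaH1Data κ v ((tateRep W 2).toLocal v) γᵥ}
  {J' : LocalIwasawaH1Data κ v (tateLocalOrdinaryRep W 2 v) γᵥ}
  {J_A : LocalIwasawaH1Data κ v ((tateRep A 2).toLocal v) γᵥ}
  {uA : ((tateRep A 2).toLocal v).toTopRep ⟶ ((tateRep W 2).toLocal v).toTopRep}
  {hsurj : Function.Surjective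
    (κ.toContinuousMonoidHom.comp (resGalOfEmb (closureEmb (K := ℚ) (v.adicCompletion ℚ))))}
  {hγ : κ.IsTopGenerator γ}
  {hγᵥ : κ.IsTopGenerator (resGalOfEmb (closureEmb (K := ℚ) (v.adicCompletion ℚ)) γᵥ)}
  {K : Type} [Field K] [NumberField K] {κK : ZpExtension K 2} {γK : absoluteGaloisGroup K}
  {w : HeightOneSpectrum (𝓞 K)}
  {DGr : (W.baseChange K).GreenbergStrictSelmerDualData κK γK (AcSelmer.bdpData (MK W K) 2 w)}
  {Dfi : (W.baseChange K).GreenbergStrictSelmerDualData κK γK (fineData W K)}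
  {L₀ L₀' : IwasawaAlgebra 2} {b b' : ℕ}
  (S : ShapiroKatoGreenbergDatum I_W I_A J J' J_A uA hsurj hγ hγᵥ DGr Dfi L₀ L₀' b b')

/-- **`gD = λ(H_f ⧸ (H_f ⊓ S)) + λ(Λ ⧸ (L₀, L₀'))`** for every Shapiro datum with `L₀ ≠ 0` (through its core).
[cite: Kato2004Asterisque, Thm 16.6 (2), §17.13 (shape)] -/
theorem ShapiroKatoGreenbergDatum.gD_eq_lambda_plusSide_add (hL₀ : L₀ ≠ 0) :
    S.gD = lambdaInvariant 2 (↥(localOrdinaryPart J' J) ⧸ (S.toPinnedKatoCore.zetaSpan).comap (localOrdinaryPart J' J).subtype) +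
      lambdaInvariant 2 (IwasawaAlgebra 2 ⧸ (Ideal.span {L₀} ⊔ Ideal.span {L₀'})) :=
  S.toPinnedKatoCore.gD_eq_lambda_plusSide_add hL₀

/-- **The research stub 6″, datum by datum, is about the `F⁺`-summand** (as 6′ was): `gD ≤ λ(X_Gr)` iff
`λ(H_f ⧸ (H_f ⊓ S)) + λ(Λ ⧸ (L₀, L₀')) ≤ λ(X_Gr)`. [cite: Kato2004Asterisque, §17.13 (shape)] -/
theorem ShapiroKatoGreenbergDatum.gD_le_lambda_iff_plusSide (hL₀ : L₀ ≠ 0) :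
    S.gD ≤ lambdaInvariant 2 DGr.X ↔
      lambdaInvariant 2 (↥(localOrdinaryPart J' J) ⧸ (S.toPinnedKatoCore.zetaSpan).comap (localOrdinaryPart J' J).subtype) +
        lambdaInvariant 2 (IwasawaAlgebra 2 ⧸ (Ideal.span {L₀} ⊔ Ideal.span {L₀'})) ≤ lambdaInvariant 2 DGr.X := by
  rw [S.gD_eq_lambda_plusSide_add hL₀]

end Shapiro

end Summit.BirchSwinnertonDyer.BirchSwinnertonDyer.Theorems.TwoAdicKatoDeterminant

end
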